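import Mathlib.Probability.Distributions.Uniform
import Mathlib.GroupTheory.GroupAction.Quotient
import HarnessLib

/-!
# Re-randomising inside an orbit: a uniform group element carries a point to a uniform point of its orbit

Topic `Probability/Distributions`.  For a finite group `G` acting on `X` and a point `x`, the
push-forward of the uniform law on `G` under `g ↦ g • x` is the uniform law on the orbit `G • x`
(every point of the orbit is hit by exactly `|Stab(x)|` group elements, and `|G • x| · |Stab(x)| = |G|`,
the orbit–stabiliser theorem, Mathlib `MulAction.card_orbit_mul_card_stabilizer_eq_card_group`).
This is the probabilistic content of every RANDOM SELF-REDUCTION BY RE-RANDOMISATION INSIDE AN ORBIT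
(graph isomorphism, code / tensor / polynomial equivalence, group-action cryptography): an instance
`y` of the orbit of `x`, hit with a uniform `g`, becomes a uniform instance of the same orbit,
whatever `y` was.  Contents (all proved):

* `card_filter_smul_eq_card_stabilizer` — `#{g | g • x = g₀ • x} = |Stab(x)|`;
* `uniformOfFintype_map_smul_apply` — point masses of the push-forward;
* **`uniformOfFintype_map_smul`** — `(U G).map (· • x) = U (G • x)`;
* `uniformOfFintype_map_smul_eq_of_mem_orbit` — the law does not depend on the point of the orbit.

First user: the crux chain of `Summits/PneNP` route `SzkEntropy`, crux `PeaWorstToAvg`, card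
`orbit-pair-rsr` (re-randomisation of cubic maps under `Aff_s(F₂) × Aff_m(F₂)`).

## References

* O. Goldreich, *Foundations of Cryptography I*, CUP 2001, §4.3.2 (the zero-knowledge proof for graph
  isomorphism: "a random isomorphic copy is uniformly distributed over the isomorphism class").
* M. Blum, S. Micali / folklore: random self-reducibility by re-randomisation (cf. J. Feigenbaum,
  L. Fortnow, *Random-self-reducibility of complete sets*, SIAM J. Comput. 22 (1993), §1).
* Mathlib `MulAction.card_orbit_mul_card_stabilizer_eq_card_group` (orbit–stabiliser).
-/

namespace Literature.Probability.Distributions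

open MulAction Finset
open scoped ENNReal

variable {G X : Type*} [Group G] [Fintype G] [MulAction G X] [DecidableEq X]

/-- **Every point of the orbit is hit equally often**: the group elements carrying `x` to `g₀ • x`
are the coset `g₀ · Stab(x)`, so there are `|Stab(x)|` of them. [folklore] -/
theorem card_filter_smul_eq_card_stabilizer [DecidableEq G] (x : X) (g₀ : G)
    [Fintype (stabilizer G x)] :
    (univ.filter fun g : G => g • x = g₀ • x).card = Fintype.card (stabilizer G x) := by
  rw [← Fintype.card_subtype]
  refine Fintype.card_congr
    { toFun := fun g => ⟨g₀⁻¹ * g.1, by rw [mem_stabilizer_iff, mul_smul, g.2, inv_smul_smul]⟩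
      invFun := fun s => ⟨g₀ * s.1, by rw [mul_smul, (mem_stabilizer_iff).1 s.2]⟩
      left_inv := fun g => by simp
      right_inv := fun s => by simp }

/-- **Point masses of the re-randomised point**: `Pr_g[g • x = y] = 1/|G • x|` for `y` in the orbit of
`x`, and `0` otherwise (membership phrased in the finset of the orbit, which is decidable).
[cite: Goldreich2001, §4.3.2] -/
theorem uniformOfFintype_map_smul_apply (x y : X) [Fintype (orbit G x)] :
    (PMF.uniformOfFintype G).map (· • x) y =
      if y ∈ (orbit G x).toFinset then (Fintype.card (orbit G x) : ℝ≥0∞)⁻¹ else 0 := by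
  classical
  have _ : Nonempty G := One.instNonempty
  -- the push-forward as a count
  have hcount : (PMF.uniformOfFintype G).map (· • x) y =
      ((univ.filter fun g : G => g • x = y).card : ℝ≥0∞) / Fintype.card G := by
    have hset : (univ.filter fun g : G => g ∈ (· • x) ⁻¹' {y}) = univ.filter fun g : G => g • x = y := by
      ext g; simp
    rw [← PMF.toOuterMeasure_apply_singleton, PMF.toOuterMeasure_map_apply, PMF.uniformOfFintype,
      PMF.toOuterMeasure_uniformOfFinset_apply, card_univ, hset]
  rw [hcount]
  split_ifs with hy
  · obtain ⟨g₀, rfl⟩ := mem_orbit_iff.1 (Set.mem_toFinset.1 hy)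
    rw [card_filter_smul_eq_card_stabilizer x g₀,
      ← card_orbit_mul_card_stabilizer_eq_card_group G x, Nat.cast_mul]
    have hs : 0 < Fintype.card (stabilizer G x) :=
      Fintype.card_pos_iff.2 ⟨(⟨1, (mem_stabilizer_iff).2 (one_smul _ _)⟩ : stabilizer G x)⟩
    have ho : 0 < Fintype.card (orbit G x) := Fintype.card_pos_iff.2 ⟨(⟨x, mem_orbit_self x⟩ : orbit G x)⟩
    have hs0 : (Fintype.card (stabilizer G x) : ℝ≥0∞) ≠ 0 := by exact_mod_cast hs.ne'
    have ho0 : (Fintype.card (orbit G x) : ℝ≥0∞) ≠ 0 := by exact_mod_cast ho.ne'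
    rw [ENNReal.div_eq_inv_mul, ENNReal.mul_inv (Or.inl ho0) (Or.inl (ENNReal.natCast_ne_top _)),
      mul_assoc, ENNReal.inv_mul_cancel hs0 (ENNReal.natCast_ne_top _), mul_one]
  · have h0 : (univ.filter fun g : G => g • x = y).card = 0 := by
      rw [card_eq_zero, filter_eq_empty_iff]
      intro g _ hg
      exact hy (Set.mem_toFinset.2 (mem_orbit_iff.2 ⟨g, hg⟩))
    rw [h0, Nat.cast_zero, ENNReal.zero_div]

omit [Fintype G] [DecidableEq X] in
/-- The orbit of `x`, as a finset, is nonempty (it contains `x`). [folklore] -/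
theorem toFinset_orbit_nonempty (x : X) [Fintype (orbit G x)] : (orbit G x).toFinset.Nonempty :=
  ⟨x, Set.mem_toFinset.2 (mem_orbit_self x)⟩

/-- **Re-randomising inside an orbit gives the uniform law on the orbit**:
`(U G).map (g ↦ g • x) = U (G • x)`. [cite: Goldreich2001, §4.3.2] -/
theorem uniformOfFintype_map_smul (x : X) [Fintype (orbit G x)] :
    (PMF.uniformOfFintype G).map (· • x) =
      PMF.uniformOfFinset (orbit G x).toFinset (toFinset_orbit_nonempty x) := by
  ext y
  rw [uniformOfFintype_map_smul_apply, PMF.uniformOfFinset_apply, Set.toFinset_card]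
  split_ifs <;> rfl

/-- **The re-randomised law only depends on the orbit**: for `y ∈ G • x`, hitting `y` with a uniform
group element gives the same law as hitting `x` — the random self-reduction property. [cite: Goldreich2001, §4.3.2] -/
theorem uniformOfFintype_map_smul_eq_of_mem_orbit {x y : X} (h : y ∈ orbit G x)
    [Fintype (orbit G x)] [Fintype (orbit G y)] :
    (PMF.uniformOfFintype G).map (· • y) = (PMF.uniformOfFintype G).map (· • x) := by
  ext z
  have ho : orbit G y = orbit G x := orbit_eq_iff.2 h
  have hc : Fintype.card (orbit G y) = Fintype.card (orbit G x) := Fintype.card_congr (Equiv.setCongr ho)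
  have hmem : z ∈ (orbit G y).toFinset ↔ z ∈ (orbit G x).toFinset := by
    rw [Set.mem_toFinset, Set.mem_toFinset, ho]
  rw [uniformOfFintype_map_smul_apply, uniformOfFintype_map_smul_apply, hc]
  exact if_congr hmem rfl rfl

end Literature.Probability.Distributions
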